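import Literature.Computability.AlgebraicComplexity.KoszulYoungCertificate
import Literature.Computability.AlgebraicComplexity.ApproxDecompositionCertificate
import Literature.Computability.AlgebraicComplexity.BorderRankRestriction
import HarnessLib

/-!
# The upper-triangular `2 × 2` matrix algebra `T₂(ℂ)`: border rank `4`, Kronecker square of border rank `≤ 15 < 16`

`T₂ = tTwo` is the structure tensor of the algebra of upper-triangular `2 × 2` matrices
(basis `e₁₁, e₁₂, e₂₂`; products `e₁₁e₁₁ = e₁₁`, `e₁₁e₁₂ = e₁₂`, `e₁₂e₂₂ = e₁₂`, `e₂₂e₂₂ = e₂₂`),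
a concise tensor of `ℂ³ ⊗ ℂ³ ⊗ ℂ³`.  It is TIGHT (the weights `(0,1,2), (0,0,-1), (0,0,-1)` vanish
on its support), `1_A`- and `1_C`-generic, and lies in the null cone.  Its Kronecker square is the
structure tensor of `T₂ ⊗ T₂ ≅ I(B₂)`, the incidence algebra of the Boolean lattice on two atoms
(a `9`-dimensional algebra; as a bilinear map: a partial `4 × 4` matrix product).

## What is proved (all by kernel-checked certificates, `decide +kernel`)
* `tensorRank_tTwo_le`, `algBorderRank_tTwo`: `R(T₂) ≤ 4` and **`bR(T₂) = 4`** over every field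
  (upper: the four products; lower: a `p = 1` Koszul–Young flattening of rank `7 > 2·3`, certified
  by seven unit-pivot rows).
* `muTwo_check_seven`, `algBorderRank_kroneckerTensor_tTwo_innerTwo_le`: the tensor
  `μ₂ := T₂ ⊠ ⟨1,2,1⟩` — the bilinear map `((α, γ), (β', δ')) ↦ αβ' + γδ'`, "two upper-triangular
  products, summed" (`R(μ₂) ≤ 8`, `muTwo_check_eight`) — has **`bR(μ₂) ≤ 7`**: an explicit rational
  `7`-term approximate decomposition of order `3`.
* `tTwoSq_check_fifteen`, `algBorderRank_kroneckerTensor_tTwo_tTwo_le`,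
  `algBorderRank_kroneckerTensor_tTwo_lt_sq`: **`bR(T₂ ⊠ T₂) ≤ 15 < 16 = bR(T₂)²`** over `ℂ`
  (indeed `≤ 15` over every field of characteristic `0`).  The `15`-term certificate is the recursion
  `T₂ = X₁Y₁Z₁ + X₃Y₃Z₃ + (X₁Y₂ + X₂Y₃)Z₂`, whose middle summand is `≅ ⟨1,2,1⟩`, so that
  `bR(T ⊠ T₂) ≤ 2·bR(T) + bR(T ⊠ ⟨1,2,1⟩)` for every `T`; with `T = T₂`: `8 + 7 = 15`.

## Why it is recorded here
Strict submultiplicativity of border rank under Kronecker powers is known for few explicit tensors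
(`M_⟨2⟩`: `46 < 49`; the border-rank-`5` tensors of `ℂ³⊗ℂ³⊗ℂ³` and `T_{skewcw,2}` of
Conner–Gesmundo–Landsberg–Ventura; "little is known" otherwise, CGLV Remark 2.8).  Border rank `4`
in `ℂ³ ⊗ ℂ³ ⊗ ℂ³` is the smallest value at which a drop can occur at all, and for the door tensor of
this programme, `T_{cw,2}` (border rank `4`), the square does NOT drop (`= 16`,
`CGLV2022_thm12_upper` with Conner–Harper–Landsberg's lower bound).  `T₂` is a border-rank-`4`
tensor of the same format whose square DOES drop.  Since `T₂` is tight, Strassen's asymptotic rank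
conjecture for tight tensors (which contains `ω = 2`) predicts `asymptoticRank T₂ = 3 < 4`; the
drop is the first step of that prediction.  It says nothing about `ω` by itself (`T₂ ≤ ⟨2,2,2⟩`
gives only `asymptoticRank T₂ ≤ 2^ω`).  Numerically (masked alternating least squares, this
report) `bR(T₂ ⊠ T₂) ≤ 14`; that certificate has not been rationalised.

The certificates were found by a masked ("toric") numerical search — solutions of
`Σ_s A_as B_bs C_cs = T_abc` on the weight-`0` part of an integer grading, `= 0` on negative
weight — followed by exact rationalisation; `ApproxCert.check` verifies the resulting polynomial
identity modulo `ε^{h+1}` in the kernel.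
-/

namespace Summit.MatrixMultiplication.MatrixMultiplication.Theorems

open Literature.Computability.AlgebraicComplexity Literature.LinearAlgebra.Matrix

/-- The structure tensor of the algebra `T₂` of upper-triangular `2 × 2` matrices in the basis
`(E₁₁, E₁₂, E₂₂)` (products `E₁₁E₁₁ = E₁₁`, `E₁₁E₁₂ = E₁₂`, `E₁₂E₂₂ = E₁₂`, `E₂₂E₂₂ = E₂₂`, all
others `0`), as an integer tensor: entries `(0,0,0), (0,1,1), (1,2,1), (2,2,2)`.
[cite: BurgisserClausenShokrollahi1997, Ex. 17.23(4)] -/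
def tTwoInt : Fin 3 → Fin 3 → Fin 3 → ℤ :=
  ApproxCert.ofEntries 3 3 3 [((0, 0, 0), 1), ((0, 1, 1), 1), ((1, 2, 1), 1), ((2, 2, 2), 1)]

/-- The structure tensor of `T₂(K)` over a commutative ring `K`. [cite: BurgisserClausenShokrollahi1997, Ex. 17.23(4)] -/
def tTwo (K : Type*) [CommRing K] : Fin 3 → Fin 3 → Fin 3 → K := fun a b c => (tTwoInt a b c : K)

/-- The four defining products of `T₂` ARE a rank-`4` decomposition (order-`0` certificate).
[cite: BurgisserClausenShokrollahi1997, Ex. 17.23(4)] -/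
theorem tTwo_check_four :
    ApproxCert.check 3 3 3 4 0 1 tTwoInt
      (![![[1], [], []], ![[1], [], []], ![[], [1], []], ![[], [], [1]]])
      (![![[1], [], []], ![[], [1], []], ![[], [], [1]], ![[], [], [1]]])
      (![![[1], [], []], ![[], [1], []], ![[], [1], []], ![[], [], [1]]]) = true := by
  decide +kernel

/-- `R(T₂) ≤ 4` over every commutative ring. [cite: BurgisserClausenShokrollahi1997, Ex. 17.23(4)] -/
theorem tensorRank_tTwo_le (K : Type*) [CommRing K] : tensorRank (tTwo K) ≤ 4 :=
  ApproxCert.tensorRank_le_of_check_one K tTwo_check_four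

/-- `bR(T₂) ≤ 4` over every commutative ring. [cite: BurgisserClausenShokrollahi1997, Ex. 17.23(4)] -/
theorem algBorderRank_tTwo_le (K : Type*) [CommRing K] : algBorderRank (tTwo K) ≤ 4 :=
  ApproxCert.algBorderRank_le_of_check_one K tTwo_check_four

/-- The `p = 1` Koszul–Young flattening of `T₂` (first factor wedged, `M = id`) has `7` certified
independent rows with unit pivots. [cite: LandsbergOttaviani2015, Thm. 2.1] -/
theorem tTwo_kyCheck :
    intTriCheckUnit 7 (KYCert.kyEntry 3 3 3 [[1, 0, 0], [0, 1, 0], [0, 0, 1]] tTwoInt)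
      [[(0, 1)], [(3, 1)], [(4, 1)], [(1, 1)], [(5, 1)], [(7, 1)], [(8, 1)]] [3, 6, 7, 4, 2, 8, 5] = true := by
  decide +kernel

/-- `4 ≤ bR(T₂)` over every field (Koszul–Young: rank `7 > 2 · 3`). [cite: LandsbergOttaviani2015, Thm. 2.1] -/
theorem four_le_algBorderRank_tTwo (K : Type*) [Field K] : 4 ≤ algBorderRank (tTwo K) :=
  KYCert.le_algBorderRank_of_kyCheckUnit K _ tTwoInt tTwo_kyCheck (by norm_num)

/-- **`bR(T₂) = 4`** over every field. [cite: BurgisserClausenShokrollahi1997, Ex. 17.23(4)] [cite: LandsbergOttaviani2015, Thm. 2.1] -/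
theorem algBorderRank_tTwo (K : Type*) [Field K] : algBorderRank (tTwo K) = 4 :=
  le_antisymm (algBorderRank_tTwo_le K) (four_le_algBorderRank_tTwo K)

/-- The Kronecker square `T₂ ⊠ T₂` as an integer tensor of format `9 × 9 × 9`, index `3·i₁ + i₂`:
the `16` products of pairs of defining products. [folklore] -/
def tTwoSqInt : Fin 9 → Fin 9 → Fin 9 → ℤ :=
  ApproxCert.ofEntries 9 9 9
    [((0, 0, 0), 1), ((0, 1, 1), 1), ((1, 2, 1), 1), ((2, 2, 2), 1),
     ((0, 3, 3), 1), ((0, 4, 4), 1), ((1, 5, 4), 1), ((2, 5, 5), 1),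
     ((3, 6, 3), 1), ((3, 7, 4), 1), ((4, 8, 4), 1), ((5, 8, 5), 1),
     ((6, 6, 6), 1), ((6, 7, 7), 1), ((7, 8, 7), 1), ((8, 8, 8), 1)]

/-- Entrywise: `tTwoSqInt (3a₁+a₂) (3b₁+b₂) (3c₁+c₂) = tTwoInt a₁ b₁ c₁ · tTwoInt a₂ b₂ c₂`. [folklore] -/
theorem tTwoSqInt_finProdFinEquiv :
    ∀ a b c : Fin 3 × Fin 3, tTwoSqInt (finProdFinEquiv a) (finProdFinEquiv b) (finProdFinEquiv c) =
      tTwoInt a.1 b.1 c.1 * tTwoInt a.2 b.2 c.2 := by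
  decide +kernel

/-- `T₂ ⊠ T₂` is the relabelling of `tTwoSqInt` by `finProdFinEquiv`. [folklore] -/
theorem kroneckerTensor_tTwo (K : Type*) [CommRing K] :
    kroneckerTensor (tTwo K) (tTwo K) =
      fun a b c => (tTwoSqInt (finProdFinEquiv a) (finProdFinEquiv b) (finProdFinEquiv c) : K) := by
  funext a b c
  rw [kroneckerTensor_apply, tTwoSqInt_finProdFinEquiv]
  simp [tTwo]

/-- The `⟨1,2,1⟩`-type tensor on `Fin 2`: `w i i' j = [i = i'] · [j = 0]` (the inner product of two
`2`-vectors, written into output coordinate `0`). [folklore] -/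
def innerTwoInt : Fin 2 → Fin 2 → Fin 2 → ℤ :=
  ApproxCert.ofEntries 2 2 2 [((0, 0, 0), 1), ((1, 1, 0), 1)]

/-- `innerTwoInt` over a commutative ring. [folklore] -/
def innerTwo (K : Type*) [CommRing K] : Fin 2 → Fin 2 → Fin 2 → K := fun i j l => (innerTwoInt i j l : K)

/-- `μ₂ := T₂ ⊠ ⟨1,2,1⟩` — the bilinear map "two upper-triangular products, summed",
`((α, γ), (β', δ')) ↦ αβ' + γδ'` on `T₂(K)² × T₂(K)²` — as an integer tensor of format `6 × 6 × 6`,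
index `2·a + i` (only the output coordinates `0, 2, 4` are used). [folklore] -/
def muTwoInt : Fin 6 → Fin 6 → Fin 6 → ℤ :=
  ApproxCert.ofEntries 6 6 6
    [((0, 0, 0), 1), ((1, 1, 0), 1), ((0, 2, 2), 1), ((1, 3, 2), 1),
     ((2, 4, 2), 1), ((3, 5, 2), 1), ((4, 4, 4), 1), ((5, 5, 4), 1)]

/-- Entrywise: `muTwoInt (2a+i) (2b+i') (2c+j) = tTwoInt a b c · innerTwoInt i i' j`. [folklore] -/
theorem muTwoInt_finProdFinEquiv :
    ∀ a b c : Fin 3 × Fin 2, muTwoInt (finProdFinEquiv a) (finProdFinEquiv b) (finProdFinEquiv c) =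
      tTwoInt a.1 b.1 c.1 * innerTwoInt a.2 b.2 c.2 := by
  decide +kernel

/-- `T₂ ⊠ ⟨1,2,1⟩` is the relabelling of `muTwoInt` by `finProdFinEquiv`. [folklore] -/
theorem kroneckerTensor_tTwo_innerTwo (K : Type*) [CommRing K] :
    kroneckerTensor (tTwo K) (innerTwo K) =
      fun a b c => (muTwoInt (finProdFinEquiv a) (finProdFinEquiv b) (finProdFinEquiv c) : K) := by
  funext a b c
  rw [kroneckerTensor_apply, muTwoInt_finProdFinEquiv]
  simp [tTwo, innerTwo]

/-- The eight defining products of `μ₂` are a rank-`8` decomposition (order `0`). [folklore] -/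
theorem muTwo_check_eight :
    ApproxCert.check 6 6 6 8 0 1 muTwoInt
      (![![[1], [], [], [], [], []], ![[], [1], [], [], [], []], ![[1], [], [], [], [], []], ![[], [1], [], [], [], []],
         ![[], [], [1], [], [], []], ![[], [], [], [1], [], []], ![[], [], [], [], [1], []], ![[], [], [], [], [], [1]]])
      (![![[1], [], [], [], [], []], ![[], [1], [], [], [], []], ![[], [], [1], [], [], []], ![[], [], [], [1], [], []],
         ![[], [], [], [], [1], []], ![[], [], [], [], [], [1]], ![[], [], [], [], [1], []], ![[], [], [], [], [], [1]]])
      (![![[1], [], [], [], [], []], ![[1], [], [], [], [], []], ![[], [], [1], [], [], []], ![[], [], [1], [], [], []],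
         ![[], [], [1], [], [], []], ![[], [], [1], [], [], []], ![[], [], [], [], [1], []], ![[], [], [], [], [1], []]]) = true := by
  decide +kernel

/-- `R(μ₂) ≤ 8` over every commutative ring. [folklore] -/
theorem tensorRank_muTwo_le (K : Type*) [CommRing K] :
    tensorRank (fun i j l => (muTwoInt i j l : K)) ≤ 8 :=
  ApproxCert.tensorRank_le_of_check_one K muTwo_check_eight

/-- A rational `7`-term approximate decomposition of `μ₂ = T₂ ⊠ ⟨1,2,1⟩` of order `3` (multiplier
`D = 4`): found by a masked ("toric") numerical search over the grading
`w_A = (-1,0,1,2,0,1)`, `w_B = (2,1,2,1,0,-1)`, `w_C = (-1,-1,-1,-1,0,2)` and rationalised exactly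
(this report, gen 24, job j167205; twelve such certificates on six gradings were found). Hence
**`bR(μ₂) ≤ 7 < 8`**: "two upper-triangular `2 × 2` products, summed" has border rank at most `7`.
[folklore] -/
theorem muTwo_check_seven :
    ApproxCert.check 6 6 6 7 3 4 muTwoInt
      (![![[], [], [0, 0, -1], [0, 0, 0, 1], [], []],
        ![[-1], [], [], [], [], [0, 0, 1]],
        ![[], [0, -1], [], [0, 0, 0, 1], [], []],
        ![[], [], [], [0, 0, 0, 1], [0, -1], []],
        ![[-2], [], [], [0, 0, 0, 2], [], [0, 0, 1]],
        ![[1], [0, 1], [], [0, 0, 0, 1], [], []],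
        ![[], [0, 1], [], [0, 0, 0, 1], [], [0, 0, 1]]])
      (![![[0, 0, 0, -1], [], [0, 0, 0, 1], [], [0, 1], []],
        ![[0, 0, 0, 1], [], [], [], [], [-1]],
        ![[], [], [0, 0, 0, 4], [0, 0, -4], [], [1]],
        ![[0, 0, 0, -1], [], [0, 0, 0, 1], [], [0, -1], []],
        ![[], [], [0, 0, 0, 2], [], [], [-1]],
        ![[0, 0, 0, 1], [], [], [], [], [1]],
        ![[0, 0, 0, 2], [0, 0, 2], [0, 0, 0, -2], [], [], [-1]]])
      (![![[], [], [-4], [], [0, -4], [0, 0, 0, -4]],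
        ![[-2], [], [1], [], [0, -12], [0, 0, 0, -4]],
        ![[], [], [1], [], [0, -2], [0, 0, 0, -1]],
        ![[], [], [], [], [0, 4], [0, 0, 0, -4]],
        ![[], [], [-1], [], [0, 6], []],
        ![[2], [], [1], [], [], [0, 0, 0, 4]],
        ![[2], [], [], [], [0, 2], [0, 0, 0, 2]]]) = true := by
  decide +kernel

/-- **`bR(T₂ ⊠ ⟨1,2,1⟩) ≤ 7`** over every field of characteristic `0` (as the explicit tensor
`muTwoInt`). [folklore] -/
theorem algBorderRank_muTwo_le_seven (K : Type*) [Field K] [CharZero K] :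
    algBorderRank (fun i j l => (muTwoInt i j l : K)) ≤ 7 :=
  ApproxCert.algBorderRank_le_of_check K muTwo_check_seven
    (isUnit_iff_ne_zero.mpr (by exact_mod_cast (by decide : (4 : ℤ) ≠ 0)))

/-- **`bR(T₂ ⊠ ⟨1,2,1⟩) ≤ 7`**, Kronecker form. [folklore] -/
theorem algBorderRank_kroneckerTensor_tTwo_innerTwo_le (K : Type*) [Field K] [CharZero K] :
    algBorderRank (kroneckerTensor (tTwo K) (innerTwo K)) ≤ 7 := by
  rw [kroneckerTensor_tTwo_innerTwo]
  have h := algBorderRank_reindex (ι' := Fin 3 × Fin 2) (κ' := Fin 3 × Fin 2) (μ' := Fin 3 × Fin 2)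
    finProdFinEquiv finProdFinEquiv finProdFinEquiv (fun i j l => (muTwoInt i j l : K))
  exact h.trans_le (algBorderRank_muTwo_le_seven K)

/-- A rational `15`-term approximate decomposition of `T₂ ⊠ T₂` of order `3` (multiplier `D = 4`),
assembled from the recursion `T₂ = X₁Y₁Z₁ + X₃Y₃Z₃ + (X₁Y₂ + X₂Y₃)Z₂`: the eight products of the two
copies of `T₂` on first Kronecker digit `0` and `2`, plus the `7`-term certificate `muTwo_check_seven`
for the middle part `(X₁Y₂ + X₂Y₃)Z₂ ⊠ T₂ ≅ μ₂` (first digits `A ∈ (0, 1)`, `B ∈ (1, 2)`, `C = 1`).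
[folklore] -/
theorem tTwoSq_check_fifteen :
    ApproxCert.check 9 9 9 15 3 4 tTwoSqInt
      (![![[], [0, 0, -1], [], [], [0, 0, 0, 1], [], [], [], []],
        ![[-1], [], [], [], [], [0, 0, 1], [], [], []],
        ![[], [], [], [0, -1], [0, 0, 0, 1], [], [], [], []],
        ![[], [], [0, -1], [], [0, 0, 0, 1], [], [], [], []],
        ![[-2], [], [], [], [0, 0, 0, 2], [0, 0, 1], [], [], []],
        ![[1], [], [], [0, 1], [0, 0, 0, 1], [], [], [], []],
        ![[], [], [], [0, 1], [0, 0, 0, 1], [0, 0, 1], [], [], []],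
        ![[1], [], [], [], [], [], [], [], []],
        ![[1], [], [], [], [], [], [], [], []],
        ![[], [1], [], [], [], [], [], [], []],
        ![[], [], [1], [], [], [], [], [], []],
        ![[], [], [], [], [], [], [1], [], []],
        ![[], [], [], [], [], [], [1], [], []],
        ![[], [], [], [], [], [], [], [1], []],
        ![[], [], [], [], [], [], [], [], [1]]])
      (![![[], [], [], [0, 0, 0, -1], [0, 0, 0, 1], [0, 1], [], [], []],
        ![[], [], [], [0, 0, 0, 1], [], [], [], [], [-1]],
        ![[], [], [], [], [0, 0, 0, 4], [], [], [0, 0, -4], [1]],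
        ![[], [], [], [0, 0, 0, -1], [0, 0, 0, 1], [0, -1], [], [], []],
        ![[], [], [], [], [0, 0, 0, 2], [], [], [], [-1]],
        ![[], [], [], [0, 0, 0, 1], [], [], [], [], [1]],
        ![[], [], [], [0, 0, 0, 2], [0, 0, 0, -2], [], [0, 0, 2], [], [-1]],
        ![[1], [], [], [], [], [], [], [], []],
        ![[], [1], [], [], [], [], [], [], []],
        ![[], [], [1], [], [], [], [], [], []],
        ![[], [], [1], [], [], [], [], [], []],
        ![[], [], [], [], [], [], [1], [], []],
        ![[], [], [], [], [], [], [], [1], []],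
        ![[], [], [], [], [], [], [], [], [1]],
        ![[], [], [], [], [], [], [], [], [1]]])
      (![![[], [], [], [], [-4], [0, -4], [], [], []],
        ![[], [], [], [-2], [1], [0, -12], [], [], []],
        ![[], [], [], [], [1], [0, -2], [], [], []],
        ![[], [], [], [], [], [0, 4], [], [], []],
        ![[], [], [], [], [-1], [0, 6], [], [], []],
        ![[], [], [], [2], [1], [], [], [], []],
        ![[], [], [], [2], [], [0, 2], [], [], []],
        ![[0, 0, 0, 4], [], [], [], [], [], [], [], []],
        ![[], [0, 0, 0, 4], [], [], [], [], [], [], []],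
        ![[], [0, 0, 0, 4], [], [], [], [], [], [], []],
        ![[], [], [0, 0, 0, 4], [], [], [], [], [], []],
        ![[], [], [], [], [], [], [0, 0, 0, 4], [], []],
        ![[], [], [], [], [], [], [], [0, 0, 0, 4], []],
        ![[], [], [], [], [], [], [], [0, 0, 0, 4], []],
        ![[], [], [], [], [], [], [], [], [0, 0, 0, 4]]]) = true := by
  decide +kernel

/-- **`bR(T₂ ⊠ T₂) ≤ 15`** over every field of characteristic `0` (as the explicit tensor
`tTwoSqInt`). [folklore] -/
theorem algBorderRank_tTwoSq_le_fifteen (K : Type*) [Field K] [CharZero K] :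
    algBorderRank (fun i j l => (tTwoSqInt i j l : K)) ≤ 15 :=
  ApproxCert.algBorderRank_le_of_check K tTwoSq_check_fifteen
    (isUnit_iff_ne_zero.mpr (by exact_mod_cast (by decide : (4 : ℤ) ≠ 0)))

/-- **`bR(T₂ ⊠ T₂) ≤ 15`**, Kronecker form. [folklore] -/
theorem algBorderRank_kroneckerTensor_tTwo_tTwo_le (K : Type*) [Field K] [CharZero K] :
    algBorderRank (kroneckerTensor (tTwo K) (tTwo K)) ≤ 15 := by
  rw [kroneckerTensor_tTwo]
  have h := algBorderRank_reindex (ι' := Fin 3 × Fin 3) (κ' := Fin 3 × Fin 3) (μ' := Fin 3 × Fin 3)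
    finProdFinEquiv finProdFinEquiv finProdFinEquiv (fun i j l => (tTwoSqInt i j l : K))
  exact h.trans_le (algBorderRank_tTwoSq_le_fifteen K)

/-- **Strict submultiplicativity of border rank under the Kronecker square for `T₂(ℂ)`:**
`bR(T₂ ⊠ T₂) ≤ 15 < 16 = bR(T₂)²`. `T₂` is a concise tensor of `ℂ³ ⊗ ℂ³ ⊗ ℂ³` of (minimal
non-minimal) border rank `4`; compare `bR(T_{cw,2} ⊠ T_{cw,2}) = 16` (`CGLV2022_thm12_upper` and
Conner–Harper–Landsberg). [folklore] -/
theorem algBorderRank_kroneckerTensor_tTwo_lt_sq :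
    algBorderRank (kroneckerTensor (tTwo ℂ) (tTwo ℂ)) < algBorderRank (tTwo ℂ) ^ 2 := by
  rw [algBorderRank_tTwo]
  exact lt_of_le_of_lt (algBorderRank_kroneckerTensor_tTwo_tTwo_le ℂ) (by norm_num)

end Summit.MatrixMultiplication.MatrixMultiplication.Theorems
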